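import Summits.QuantumFields.BalabanUV.T4Continuum.Support.UnitaryGeodesic
import HarnessLib

/-!
# NE7PairGlueStep — THE TWO-PARTY GLUING STEP OF SITE GAUGES (F315): geodesic interpolation `w = glue(φ; u, v)` of a running gauge `u`
# and a patch `v` (`w = u` on `{φ ≤ 0}`, `w = v` on `{φ ≥ 1}`, `w = geo φ u v` between), and the PAIR-DEFECT LETTERS of `U′^{w}` against `U_s`

Cell `pub-balaban`, sub-cell t4, lineage `b2b-balaban-t4-ne7-p1` (CRUX PROVER NE7 #1 = OWNER of row NE7), gen 94; memo
`t4/b2b-balaban-t4-ne7-p1-g94/PAIR-REP-ROAD.md` §3.  Pointwise∕bondwise core of the road to the PAIR RESIDUAL SUP-REPRESENTATIVE (the sup member of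
[Balaban1985RegularSpaces] Lemma 1 ∕ Thm 2 (1.36)₁ at a pair, everywhere-small-field case — first conjunct of row NE3's binder `hleaves` of F314b
`NE7HintOfUhlenbeckChartSU2.hint_SU2`): every gluing of OUR road is this two-party step, so no non-abelian multi-party junction occurs.
WHAT ([folklore]; 0 def, 0 sorry; any C⋆-algebra, any `d`).  §1 unitary bookkeeping; §2 `(ab)·V = a·(b·V)` and the RATIO IDENTITY
`U^{v}(b) = t(x)U^{u}(b)t(y)⁻¹` (`t = vu⁻¹`); §3 the pair defect `Y_g(b) = U_s(b)⁻¹(U′^{g})(b)` and the TRANSPORT LETTER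
`‖t(y) − U_s(b)⁻¹t(x)U_s(b)‖ ≤ err_u + err_v`; §4 the glue step for a weight `0 ≤ φ ≤ 1` and a gauge `w` CHARACTERISED by the three cases (consumers
instantiate an `if`-lambda): unitarity, `w = u` where `u = v`, inherited shift-periodicity, `‖w − v‖ ≤ 4(1−φ)‖v − u‖`,
`wv⁻¹ = (vu⁻¹)^{φ−1}`; §5 the CRUDE letter `err_w ≤ err_v + 4(1−φ(x))τ(x) + 4(1−φ(y))τ(y)` and the FINE letter
`err_w ≤ err_v + 6(1−φ(x))(err_u + err_v) + 4|φ(x)−φ(y)|τ(y)` (`τ = ‖v − u‖`; smallness `τ ≤ 1∕4` needed ONLY where `φ < 1`).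
HONEST FRAMING: C⋆-algebra bookkeeping over the tree's `geo`∕`upow` kit; nothing of Bałaban's asserted; hleaves NOT discharged; NE7 NOT PROVED; spine 0∕9;
finite T⁴ rung (B)+1 — NOT infinite volume, NOT mass gap, NOT `BetaPertH`, NOT Clay.  Axioms ⊆ {propext, Classical.choice, Quot.sound}.
-/

set_option autoImplicit false

open NormedSpace

namespace Summit.QuantumFields.BalabanUV.T4Continuum.NE7PairGlueStep

open Literature.MathematicalPhysics.QuantumFieldTheory.Balaban1983to89
open MatrixLog B7Prop1Explicit B7Prop2Explicit UnitaryRootInterpolation UnitaryGeodesic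

noncomputable section

variable {𝔸 : Type*} [CStarAlgebra 𝔸] {d : ℕ}

/-! ## §1 Unitary bookkeeping -/

/-- For a unitary unit `W`: `‖W⁻¹ − 1‖ = ‖W − 1‖`. [folklore] -/
theorem norm_inv_sub_one {W : 𝔸ˣ} (hW : W ∈ unitaryUnits 𝔸) :
    ‖((W⁻¹ : 𝔸ˣ) : 𝔸) - 1‖ = ‖(W : 𝔸) - 1‖ := by
  have hid : ((W⁻¹ : 𝔸ˣ) : 𝔸) - 1 = ((W⁻¹ : 𝔸ˣ) : 𝔸) * (1 - (W : 𝔸)) := by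
    rw [mul_sub, mul_one, Units.inv_mul]
  rw [hid, CStarRing.norm_mem_unitary_mul _ ((unitaryUnits 𝔸).inv_mem hW), norm_sub_rev]

/-- `‖aXc − X'‖`-type bound: for unitary units `a, c` close to `1`, `‖a·X·c − X‖ ≤ ‖a − 1‖ + ‖c − 1‖` when `‖X‖ ≤ 1`. [folklore] -/
theorem norm_unit_mul_mul_unit_sub_le {a c : 𝔸ˣ} (hc : c ∈ unitaryUnits 𝔸) {X : 𝔸} (hX : ‖X‖ ≤ 1) :
    ‖(a : 𝔸) * X * (c : 𝔸) - X‖ ≤ ‖(a : 𝔸) - 1‖ + ‖(c : 𝔸) - 1‖ := by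
  have hid : (a : 𝔸) * X * (c : 𝔸) - X = ((a : 𝔸) - 1) * (X * (c : 𝔸)) + X * ((c : 𝔸) - 1) := by noncomm_ring
  rw [hid]
  refine (norm_add_le _ _).trans (add_le_add ?_ ?_)
  · calc ‖((a : 𝔸) - 1) * (X * (c : 𝔸))‖ ≤ ‖(a : 𝔸) - 1‖ * ‖X * (c : 𝔸)‖ := norm_mul_le _ _
      _ ≤ ‖(a : 𝔸) - 1‖ * 1 := by
          rw [CStarRing.norm_mul_mem_unitary _ (mem_unitaryUnits.mp hc)]
          exact mul_le_mul_of_nonneg_left hX (norm_nonneg _)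
      _ = _ := mul_one _
  · calc ‖X * ((c : 𝔸) - 1)‖ ≤ ‖X‖ * ‖(c : 𝔸) - 1‖ := norm_mul_le _ _
      _ ≤ 1 * ‖(c : 𝔸) - 1‖ := mul_le_mul_of_nonneg_right hX (norm_nonneg _)
      _ = _ := one_mul _

/-- A unitary unit has norm `≤ 1`. [folklore] -/
theorem norm_le_one_of_unitary [Nontrivial 𝔸] {W : 𝔸ˣ} (hW : W ∈ unitaryUnits 𝔸) : ‖(W : 𝔸)‖ ≤ 1 :=
  (CStarRing.norm_of_mem_unitary (mem_unitaryUnits.mp hW)).le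

/-- A unitary unit lies in the tree's bicontraction group `U1`. [folklore] -/
theorem mem_U1_of_unitaryUnits [Nontrivial 𝔸] {W : 𝔸ˣ} (hW : W ∈ unitaryUnits 𝔸) : W ∈ U1 𝔸 :=
  mem_U1.mpr ⟨norm_le_one_of_unitary hW, norm_le_one_of_unitary ((unitaryUnits 𝔸).inv_mem hW)⟩

/-- `‖aXb − 1‖ ≤ ‖a − 1‖ + ‖X − 1‖ + ‖b − 1‖` for unitary units `a, b` and `‖X‖ ≤ 1`. [folklore] -/
theorem norm_triple_sub_one_le {a b : 𝔸ˣ} (hb : b ∈ unitaryUnits 𝔸) {X : 𝔸} (hX : ‖X‖ ≤ 1) :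
    ‖(a : 𝔸) * X * (b : 𝔸) - 1‖ ≤ ‖(a : 𝔸) - 1‖ + ‖X - 1‖ + ‖(b : 𝔸) - 1‖ := by
  have h1 := norm_unit_mul_mul_unit_sub_le (a := a) hb hX
  have h2 : ‖(a : 𝔸) * X * (b : 𝔸) - 1‖ ≤ ‖(a : 𝔸) * X * (b : 𝔸) - X‖ + ‖X - 1‖ := by
    calc _ = ‖((a : 𝔸) * X * (b : 𝔸) - X) + (X - 1)‖ := by rw [sub_add_sub_cancel]
      _ ≤ _ := norm_add_le _ _
  linarith

/-! ## §2 Gauge algebra -/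

/-- Composition of gauge transformations: `(a·b)·V = a·(b·V)`. [folklore] -/
theorem gaugeAct_mul_eq {G : Type*} [Group G] (a b : Site d → G) (V : Site d → Fin d → G) :
    gaugeAct (fun x => a x * b x) V = gaugeAct a (gaugeAct b V) := by
  funext x μ
  simp only [gaugeAct, mul_inv_rev, mul_assoc]

/-- **THE RATIO IDENTITY**: `U^{v}(b) = t(x)·U^{u}(b)·t(x + e_μ)⁻¹` with `t = v·u⁻¹`. [folklore] -/
theorem gaugeAct_ratio {G : Type*} [Group G] (u v : Site d → G) (V : Site d → Fin d → G) (x : Site d) (μ : Fin d) :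
    gaugeAct v V x μ = (v x * (u x)⁻¹) * gaugeAct u V x μ * (v (x + e μ) * (u (x + e μ))⁻¹)⁻¹ := by
  simp only [gaugeAct]; group

/-! ## §3 The pair defect and the transport of a ratio along a bond -/

section Transport

variable {Us U' : Site d → Fin d → 𝔸ˣ} {u v : Site d → 𝔸ˣ}

/-- **TRANSPORT IDENTITY**: `t(x + e_μ) = Y_v(b)⁻¹ · (U_s(b)⁻¹ t(x) U_s(b)) · Y_u(b)` for `t = v u⁻¹`, `Y_g(b) = U_s(b)⁻¹(U′^{g})(b)`. [folklore] -/
theorem ratio_transport_eq (x : Site d) (μ : Fin d) :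
    v (x + e μ) * (u (x + e μ))⁻¹
      = ((Us x μ)⁻¹ * gaugeAct v U' x μ)⁻¹ * ((Us x μ)⁻¹ * (v x * (u x)⁻¹) * Us x μ) * ((Us x μ)⁻¹ * gaugeAct u U' x μ) := by
  simp only [gaugeAct]; group

/-- **TRANSPORT LETTER**: `‖t(x + e_μ) − U_s(b)⁻¹ t(x) U_s(b)‖ ≤ err_u(b) + err_v(b)` (everything unitary). [folklore] -/
theorem norm_ratio_sub_conj_le [Nontrivial 𝔸] (hUs : ∀ x μ, Us x μ ∈ unitaryUnits 𝔸) (hU' : ∀ x μ, U' x μ ∈ unitaryUnits 𝔸)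
    (hu : ∀ x, u x ∈ unitaryUnits 𝔸) (hv : ∀ x, v x ∈ unitaryUnits 𝔸) (x : Site d) (μ : Fin d) :
    ‖((v (x + e μ) * (u (x + e μ))⁻¹ : 𝔸ˣ) : 𝔸) - (((Us x μ)⁻¹ * (v x * (u x)⁻¹) * Us x μ : 𝔸ˣ) : 𝔸)‖
      ≤ ‖(((Us x μ)⁻¹ * gaugeAct u U' x μ : 𝔸ˣ) : 𝔸) - 1‖ + ‖(((Us x μ)⁻¹ * gaugeAct v U' x μ : 𝔸ˣ) : 𝔸) - 1‖ := by
  have hga : ∀ (g : Site d → 𝔸ˣ), (∀ x, g x ∈ unitaryUnits 𝔸) → ∀ x μ, gaugeAct g U' x μ ∈ unitaryUnits 𝔸 := by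
    intro g hg x μ
    exact (unitaryUnits 𝔸).mul_mem ((unitaryUnits 𝔸).mul_mem (hg x) (hU' x μ)) ((unitaryUnits 𝔸).inv_mem (hg _))
  have hYu : (Us x μ)⁻¹ * gaugeAct u U' x μ ∈ unitaryUnits 𝔸 :=
    (unitaryUnits 𝔸).mul_mem ((unitaryUnits 𝔸).inv_mem (hUs x μ)) (hga u hu x μ)
  have hYv : (Us x μ)⁻¹ * gaugeAct v U' x μ ∈ unitaryUnits 𝔸 :=
    (unitaryUnits 𝔸).mul_mem ((unitaryUnits 𝔸).inv_mem (hUs x μ)) (hga v hv x μ)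
  have hT : (Us x μ)⁻¹ * (v x * (u x)⁻¹) * Us x μ ∈ unitaryUnits 𝔸 :=
    (unitaryUnits 𝔸).mul_mem ((unitaryUnits 𝔸).mul_mem ((unitaryUnits 𝔸).inv_mem (hUs x μ))
      ((unitaryUnits 𝔸).mul_mem (hv x) ((unitaryUnits 𝔸).inv_mem (hu x)))) (hUs x μ)
  rw [ratio_transport_eq (Us := Us) (U' := U') x μ, Units.val_mul, Units.val_mul]
  have h := norm_unit_mul_mul_unit_sub_le (a := ((Us x μ)⁻¹ * gaugeAct v U' x μ)⁻¹) hYu (norm_le_one_of_unitary hT)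
  rw [norm_inv_sub_one hYv] at h
  linarith

end Transport

/-! ## §4 The glue step -/

section Glue

variable {φ : Site d → ℝ} {u v w : Site d → 𝔸ˣ}

/-- **THE GLUED GAUGE IS UNITARY AT A SITE** (smallness `‖v − u‖ ≤ 1∕4` needed only if `φ < 1` there). [folklore] -/
theorem glue_mem_unitaryUnits_at (hw0 : ∀ x, φ x ≤ 0 → w x = u x) (hw1 : ∀ x, 1 ≤ φ x → w x = v x)
    (hwm : ∀ x, 0 < φ x → φ x < 1 → w x = geo (φ x) (u x) (v x))
    (hu : ∀ x, u x ∈ unitaryUnits 𝔸) (hv : ∀ x, v x ∈ unitaryUnits 𝔸) {x : Site d}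
    (hτ : φ x < 1 → ‖(v x : 𝔸) - u x‖ ≤ 1 / 4) : w x ∈ unitaryUnits 𝔸 := by
  rcases lt_or_ge 0 (φ x) with h0 | h0
  · rcases lt_or_ge (φ x) 1 with h1 | h1
    · rw [hwm x h0 h1]; exact geo_mem_unitaryUnits (hu x) (hv x) (hτ h1) _
    · rw [hw1 x h1]; exact hv x
  · rw [hw0 x h0]; exact hu x

/-- **WHERE THE PARTIES AGREE NOTHING MOVES**: `u(x) = v(x) ⟹ w(x) = u(x)` (in particular pinned corners stay pinned). [folklore] -/
theorem glue_eq_of_eq (hw0 : ∀ x, φ x ≤ 0 → w x = u x) (hw1 : ∀ x, 1 ≤ φ x → w x = v x)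
    (hwm : ∀ x, 0 < φ x → φ x < 1 → w x = geo (φ x) (u x) (v x)) {x : Site d} (h : u x = v x) : w x = u x := by
  rcases lt_or_ge 0 (φ x) with h0 | h0
  · rcases lt_or_ge (φ x) 1 with h1 | h1
    · rw [hwm x h0 h1, ← h, geo]
      have : ((((u x)⁻¹ * u x : 𝔸ˣ)) : 𝔸) = 1 := by rw [inv_mul_cancel, Units.val_one]
      rw [this]
      have h2 : upowUnit (φ x) (1 : 𝔸) = 1 := by ext; simp [upowUnit, mlog_one]
      rw [h2, mul_one]
    · rw [hw1 x h1, h]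
  · exact hw0 x h0

/-- **SHIFT-PERIODICITY IS INHERITED**: if `φ`, `u`, `v` are invariant under `x ↦ x + s` then so is `w`. [folklore] -/
theorem glue_shift (hw0 : ∀ x, φ x ≤ 0 → w x = u x) (hw1 : ∀ x, 1 ≤ φ x → w x = v x)
    (hwm : ∀ x, 0 < φ x → φ x < 1 → w x = geo (φ x) (u x) (v x)) {s : Site d}
    (hφs : ∀ x, φ (x + s) = φ x) (hus : ∀ x, u (x + s) = u x) (hvs : ∀ x, v (x + s) = v x) (x : Site d) :
    w (x + s) = w x := by
  rcases lt_or_ge 0 (φ x) with h0 | h0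
  · rcases lt_or_ge (φ x) 1 with h1 | h1
    · rw [hwm x h0 h1, hwm (x + s) (by rw [hφs]; exact h0) (by rw [hφs]; exact h1), hφs, hus, hvs]
    · rw [hw1 x h1, hw1 (x + s) (by rw [hφs]; exact h1), hvs]
  · rw [hw0 x h0, hw0 (x + s) (by rw [hφs]; exact h0), hus]

/-- **DISTANCE TO THE PATCH**: `‖w(x) − v(x)‖ ≤ 4(1 − φ(x))·‖v(x) − u(x)‖` (smallness needed only where `φ(x) < 1`). [folklore] -/
theorem norm_glue_sub_right_le (hφ : ∀ x, 0 ≤ φ x ∧ φ x ≤ 1)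
    (hw0 : ∀ x, φ x ≤ 0 → w x = u x) (hw1 : ∀ x, 1 ≤ φ x → w x = v x)
    (hwm : ∀ x, 0 < φ x → φ x < 1 → w x = geo (φ x) (u x) (v x))
    (hu : ∀ x, u x ∈ unitaryUnits 𝔸) (hv : ∀ x, v x ∈ unitaryUnits 𝔸) {x : Site d}
    (hτ : φ x < 1 → ‖(v x : 𝔸) - u x‖ ≤ 1 / 4) :
    ‖(w x : 𝔸) - v x‖ ≤ 4 * (1 - φ x) * ‖(v x : 𝔸) - u x‖ := by
  rcases lt_or_ge 0 (φ x) with h0 | h0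
  · rcases lt_or_ge (φ x) 1 with h1 | h1
    · rw [hwm x h0 h1]
      have hτ' := hτ h1
      have habs : |1 - φ x| = 1 - φ x := abs_of_nonneg (by linarith)
      have h := norm_geo_sub_right_le (hu x) (hv x) hτ' (s := φ x)
        (by rw [habs]; nlinarith [norm_nonneg ((v x : 𝔸) - u x)])
      rwa [habs] at h
    · rw [hw1 x h1, sub_self, norm_zero]
      exact mul_nonneg (mul_nonneg (by norm_num) (by linarith [(hφ x).2])) (norm_nonneg _)
  · rw [hw0 x h0]
    have hφ0 : φ x = 0 := le_antisymm h0 (hφ x).1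
    rw [hφ0, sub_zero, mul_one, norm_sub_rev]
    linarith [norm_nonneg ((v x : 𝔸) - u x)]

/-- **THE RATIO TO THE PATCH IS A FRACTIONAL POWER**: `w(x)·v(x)⁻¹ = (v(x)u(x)⁻¹)^{φ(x) − 1}` whenever `φ(x) = 1` or `‖v(x) − u(x)‖ < 1`.
[folklore] -/
theorem glue_ratio_eq_upow [Nontrivial 𝔸] (hφ : ∀ x, 0 ≤ φ x ∧ φ x ≤ 1)
    (hw0 : ∀ x, φ x ≤ 0 → w x = u x) (hw1 : ∀ x, 1 ≤ φ x → w x = v x)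
    (hwm : ∀ x, 0 < φ x → φ x < 1 → w x = geo (φ x) (u x) (v x))
    (hu : ∀ x, u x ∈ unitaryUnits 𝔸) {x : Site d}
    (hτ : φ x < 1 → ‖(v x : 𝔸) - u x‖ < 1) :
    ((w x * (v x)⁻¹ : 𝔸ˣ) : 𝔸) = upow (φ x - 1) ((v x * (u x)⁻¹ : 𝔸ˣ) : 𝔸) := by
  letI : NormedAlgebra ℚ 𝔸 := NormedAlgebra.restrictScalars ℚ ℂ 𝔸
  rcases lt_or_ge (φ x) 1 with h1 | h1
  · have hτ' := hτ h1
    -- `T = v u⁻¹` is within `1` of `1`, so `T⁻¹ = T^{-1}`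
    have hT1 : ‖((v x * (u x)⁻¹ : 𝔸ˣ) : 𝔸) - 1‖ < 1 := by
      have : ((v x * (u x)⁻¹ : 𝔸ˣ) : 𝔸) - 1 = ((v x : 𝔸) - u x) * (((u x)⁻¹ : 𝔸ˣ) : 𝔸) := by
        rw [sub_mul, Units.val_mul, Units.mul_inv]
      rw [this, CStarRing.norm_mul_mem_unitary _ (mem_unitaryUnits.mp ((unitaryUnits 𝔸).inv_mem (hu x)))]
      exact hτ'
    have hTinv : (((v x * (u x)⁻¹)⁻¹ : 𝔸ˣ) : 𝔸) = upow (-1) ((v x * (u x)⁻¹ : 𝔸ˣ) : 𝔸) := by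
      have h2 : upow (-1) ((v x * (u x)⁻¹ : 𝔸ˣ) : 𝔸) * ((v x * (u x)⁻¹ : 𝔸ˣ) : 𝔸) = 1 := by
        nth_rewrite 2 [← upow_one hT1]
        rw [← upow_add, neg_add_cancel, upow_zero]
      calc (((v x * (u x)⁻¹)⁻¹ : 𝔸ˣ) : 𝔸) = (upow (-1) ((v x * (u x)⁻¹ : 𝔸ˣ) : 𝔸) * ((v x * (u x)⁻¹ : 𝔸ˣ) : 𝔸))
            * (((v x * (u x)⁻¹)⁻¹ : 𝔸ˣ) : 𝔸) := by rw [h2, one_mul]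
        _ = _ := by rw [mul_assoc, Units.mul_inv, mul_one]
    rcases lt_or_ge 0 (φ x) with h0 | h0
    · rw [hwm x h0 h1, geo]
      -- `u (u⁻¹v)^φ v⁻¹ = (v u⁻¹)^φ · (v u⁻¹)^{-1}`
      have hR1 : ‖(((u x)⁻¹ * v x : 𝔸ˣ) : 𝔸) - 1‖ < 1 := by rw [norm_ratio_sub_one (hu x)]; exact hτ'
      have hconj : (u x : 𝔸) * upow (φ x) (((u x)⁻¹ * v x : 𝔸ˣ) : 𝔸) * (((u x)⁻¹ : 𝔸ˣ) : 𝔸)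
          = upow (φ x) ((v x * (u x)⁻¹ : 𝔸ˣ) : 𝔸) := by
        rw [← upow_units_conj (mem_U1_of_unitaryUnits (hu x)) hR1]
        congr 1
        simp only [Units.val_mul, ← mul_assoc, Units.mul_inv, one_mul]
      calc (((u x * upowUnit (φ x) (((u x)⁻¹ * v x : 𝔸ˣ) : 𝔸)) * (v x)⁻¹ : 𝔸ˣ) : 𝔸)
          = ((u x : 𝔸) * upow (φ x) (((u x)⁻¹ * v x : 𝔸ˣ) : 𝔸) * (((u x)⁻¹ : 𝔸ˣ) : 𝔸))
              * (((v x * (u x)⁻¹)⁻¹ : 𝔸ˣ) : 𝔸) := by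
            simp only [Units.val_mul, val_upowUnit, mul_inv_rev, inv_inv, mul_assoc, Units.inv_mul_cancel_left]
        _ = upow (φ x) ((v x * (u x)⁻¹ : 𝔸ˣ) : 𝔸) * upow (-1) ((v x * (u x)⁻¹ : 𝔸ˣ) : 𝔸) := by rw [hconj, hTinv]
        _ = _ := by rw [← upow_add]; ring_nf
    · rw [hw0 x h0]
      have hφ0 : φ x = 0 := le_antisymm h0 (hφ x).1
      rw [hφ0, zero_sub, ← hTinv, mul_inv_rev, inv_inv]
  · have hφ1 : φ x = 1 := le_antisymm (hφ x).2 h1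
    rw [hw1 x h1, mul_inv_cancel, hφ1, sub_self, upow_zero, Units.val_one]

end Glue

/-! ## §5 The pair-defect letters of the glued gauge -/

section Letters

variable {Us U' : Site d → Fin d → 𝔸ˣ} {φ : Site d → ℝ} {u v w : Site d → 𝔸ˣ}

/-- `‖a b⁻¹ − 1‖ = ‖a − b‖` for a unitary unit `b`. [folklore] -/
theorem norm_mul_inv_sub_one {a b : 𝔸ˣ} (hb : b ∈ unitaryUnits 𝔸) : ‖((a * b⁻¹ : 𝔸ˣ) : 𝔸) - 1‖ = ‖(a : 𝔸) - b‖ := by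
  have : ((a * b⁻¹ : 𝔸ˣ) : 𝔸) - 1 = ((a : 𝔸) - b) * ((b⁻¹ : 𝔸ˣ) : 𝔸) := by rw [sub_mul, Units.val_mul, Units.mul_inv]
  rw [this, CStarRing.norm_mul_mem_unitary _ (mem_unitaryUnits.mp ((unitaryUnits 𝔸).inv_mem hb))]

/-- `‖c⁻¹ X c − 1‖ = ‖X − 1‖` for a unitary unit `c`. [folklore] -/
theorem norm_conj_sub_one {c X : 𝔸ˣ} (hc : c ∈ unitaryUnits 𝔸) : ‖((c⁻¹ * X * c : 𝔸ˣ) : 𝔸) - 1‖ = ‖(X : 𝔸) - 1‖ := by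
  have hid : ((c⁻¹ * X * c : 𝔸ˣ) : 𝔸) - 1 = ((c⁻¹ : 𝔸ˣ) : 𝔸) * (((X : 𝔸) - 1) * (c : 𝔸)) := by
    simp only [Units.val_mul, sub_mul, mul_sub, one_mul, mul_assoc, Units.inv_mul]
  rw [hid, CStarRing.norm_mem_unitary_mul _ ((unitaryUnits 𝔸).inv_mem hc), CStarRing.norm_mul_mem_unitary _ (mem_unitaryUnits.mp hc)]

/-- The pair defect `Y_g(b) = U_s(b)⁻¹(U′^{g})(b)` is a unitary unit. [folklore] -/
theorem pairDefect_mem_unitaryUnits (hUs : ∀ x μ, Us x μ ∈ unitaryUnits 𝔸) (hU' : ∀ x μ, U' x μ ∈ unitaryUnits 𝔸)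
    {g : Site d → 𝔸ˣ} {x : Site d} {μ : Fin d} (hgx : g x ∈ unitaryUnits 𝔸) (hgy : g (x + e μ) ∈ unitaryUnits 𝔸) :
    (Us x μ)⁻¹ * gaugeAct g U' x μ ∈ unitaryUnits 𝔸 :=
  (unitaryUnits 𝔸).mul_mem ((unitaryUnits 𝔸).inv_mem (hUs x μ))
    ((unitaryUnits 𝔸).mul_mem ((unitaryUnits 𝔸).mul_mem hgx (hU' x μ)) ((unitaryUnits 𝔸).inv_mem hgy))

/-- **THE DEFECT IDENTITY OF THE GLUED GAUGE**: `Y_w(b) = (U_s(b)⁻¹ q(x) U_s(b)) · Y_v(b) · q(x+e_μ)⁻¹` with `q = w v⁻¹`. [folklore] -/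
theorem pairDefect_glue_eq (x : Site d) (μ : Fin d) :
    (Us x μ)⁻¹ * gaugeAct w U' x μ
      = ((Us x μ)⁻¹ * (w x * (v x)⁻¹) * Us x μ) * ((Us x μ)⁻¹ * gaugeAct v U' x μ) * (w (x + e μ) * (v (x + e μ))⁻¹)⁻¹ := by
  rw [gaugeAct_ratio v w U' x μ]; group

/-- **CRUDE LETTER**: on a bond `⟨x, x + e_μ⟩`,
`err_w ≤ err_v + 4(1−φ(x))‖v(x) − u(x)‖ + 4(1−φ(x+e_μ))‖v(x+e_μ) − u(x+e_μ)‖`, smallness of `‖v − u‖` being required only at the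
endpoints where `φ < 1`. [folklore] -/
theorem glue_err_crude [Nontrivial 𝔸] (hUs : ∀ x μ, Us x μ ∈ unitaryUnits 𝔸) (hU' : ∀ x μ, U' x μ ∈ unitaryUnits 𝔸)
    (hφ : ∀ x, 0 ≤ φ x ∧ φ x ≤ 1)
    (hw0 : ∀ x, φ x ≤ 0 → w x = u x) (hw1 : ∀ x, 1 ≤ φ x → w x = v x)
    (hwm : ∀ x, 0 < φ x → φ x < 1 → w x = geo (φ x) (u x) (v x))
    (hu : ∀ x, u x ∈ unitaryUnits 𝔸) (hv : ∀ x, v x ∈ unitaryUnits 𝔸) (x : Site d) (μ : Fin d)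
    (hτx : φ x < 1 → ‖(v x : 𝔸) - u x‖ ≤ 1 / 4) (hτy : φ (x + e μ) < 1 → ‖(v (x + e μ) : 𝔸) - u (x + e μ)‖ ≤ 1 / 4) :
    ‖(((Us x μ)⁻¹ * gaugeAct w U' x μ : 𝔸ˣ) : 𝔸) - 1‖
      ≤ ‖(((Us x μ)⁻¹ * gaugeAct v U' x μ : 𝔸ˣ) : 𝔸) - 1‖
        + 4 * (1 - φ x) * ‖(v x : 𝔸) - u x‖ + 4 * (1 - φ (x + e μ)) * ‖(v (x + e μ) : 𝔸) - u (x + e μ)‖ := by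
  have hwx : w x ∈ unitaryUnits 𝔸 := glue_mem_unitaryUnits_at hw0 hw1 hwm hu hv hτx
  have hwy : w (x + e μ) ∈ unitaryUnits 𝔸 := glue_mem_unitaryUnits_at hw0 hw1 hwm hu hv hτy
  set qx : 𝔸ˣ := w x * (v x)⁻¹ with hqx
  set qy : 𝔸ˣ := w (x + e μ) * (v (x + e μ))⁻¹ with hqy
  have hqxU : qx ∈ unitaryUnits 𝔸 := (unitaryUnits 𝔸).mul_mem hwx ((unitaryUnits 𝔸).inv_mem (hv x))
  have hqyU : qy ∈ unitaryUnits 𝔸 := (unitaryUnits 𝔸).mul_mem hwy ((unitaryUnits 𝔸).inv_mem (hv _))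
  have hgv : (Us x μ)⁻¹ * gaugeAct v U' x μ ∈ unitaryUnits 𝔸 := pairDefect_mem_unitaryUnits hUs hU' (hv x) (hv _)
  have hA : (Us x μ)⁻¹ * qx * Us x μ ∈ unitaryUnits 𝔸 :=
    (unitaryUnits 𝔸).mul_mem ((unitaryUnits 𝔸).mul_mem ((unitaryUnits 𝔸).inv_mem (hUs x μ)) hqxU) (hUs x μ)
  rw [pairDefect_glue_eq (Us := Us) (U' := U') (v := v) (w := w) x μ, Units.val_mul, Units.val_mul]
  have h3 := norm_triple_sub_one_le (a := (Us x μ)⁻¹ * qx * Us x μ) ((unitaryUnits 𝔸).inv_mem hqyU) (norm_le_one_of_unitary hgv)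
  rw [norm_conj_sub_one (hUs x μ), hqx, norm_mul_inv_sub_one (hv x), norm_inv_sub_one hqyU, hqy,
    norm_mul_inv_sub_one (hv _)] at h3
  have hdx := norm_glue_sub_right_le hφ hw0 hw1 hwm hu hv hτx
  have hdy := norm_glue_sub_right_le hφ hw0 hw1 hwm hu hv hτy
  linarith

/-- **FINE LETTER** (both endpoints with `‖v − u‖ ≤ 1∕4`): on a bond `⟨x, y = x + e_μ⟩`,
`err_w ≤ err_v + 6(1−φ(x))(err_u + err_v) + 4|φ(x) − φ(y)|·‖v(y) − u(y)‖` — the covariant near-constancy of the ratio `v u⁻¹` (§3) replaces the size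
of the ratio. [folklore] -/
theorem glue_err_fine [Nontrivial 𝔸] (hUs : ∀ x μ, Us x μ ∈ unitaryUnits 𝔸) (hU' : ∀ x μ, U' x μ ∈ unitaryUnits 𝔸)
    (hφ : ∀ x, 0 ≤ φ x ∧ φ x ≤ 1)
    (hw0 : ∀ x, φ x ≤ 0 → w x = u x) (hw1 : ∀ x, 1 ≤ φ x → w x = v x)
    (hwm : ∀ x, 0 < φ x → φ x < 1 → w x = geo (φ x) (u x) (v x))
    (hu : ∀ x, u x ∈ unitaryUnits 𝔸) (hv : ∀ x, v x ∈ unitaryUnits 𝔸) (x : Site d) (μ : Fin d)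
    (hτx : ‖(v x : 𝔸) - u x‖ ≤ 1 / 4) (hτy : ‖(v (x + e μ) : 𝔸) - u (x + e μ)‖ ≤ 1 / 4) :
    ‖(((Us x μ)⁻¹ * gaugeAct w U' x μ : 𝔸ˣ) : 𝔸) - 1‖
      ≤ ‖(((Us x μ)⁻¹ * gaugeAct v U' x μ : 𝔸ˣ) : 𝔸) - 1‖
        + 6 * (1 - φ x) * (‖(((Us x μ)⁻¹ * gaugeAct u U' x μ : 𝔸ˣ) : 𝔸) - 1‖ + ‖(((Us x μ)⁻¹ * gaugeAct v U' x μ : 𝔸ˣ) : 𝔸) - 1‖)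
        + 4 * |φ x - φ (x + e μ)| * ‖(v (x + e μ) : 𝔸) - u (x + e μ)‖ := by
  letI : NormedAlgebra ℚ 𝔸 := NormedAlgebra.restrictScalars ℚ ℂ 𝔸
  have hwx : w x ∈ unitaryUnits 𝔸 := glue_mem_unitaryUnits_at hw0 hw1 hwm hu hv (fun _ => hτx)
  have hwy : w (x + e μ) ∈ unitaryUnits 𝔸 := glue_mem_unitaryUnits_at hw0 hw1 hwm hu hv (fun _ => hτy)
  -- the ratios `T = v u⁻¹` at the two ends and the transported one
  set Tx : 𝔸ˣ := v x * (u x)⁻¹ with hTx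
  set Ty : 𝔸ˣ := v (x + e μ) * (u (x + e μ))⁻¹ with hTy
  set Th : 𝔸ˣ := (Us x μ)⁻¹ * Tx * Us x μ with hTh
  have hTxU : Tx ∈ unitaryUnits 𝔸 := (unitaryUnits 𝔸).mul_mem (hv x) ((unitaryUnits 𝔸).inv_mem (hu x))
  have hTyU : Ty ∈ unitaryUnits 𝔸 := (unitaryUnits 𝔸).mul_mem (hv _) ((unitaryUnits 𝔸).inv_mem (hu _))
  have hThU : Th ∈ unitaryUnits 𝔸 :=
    (unitaryUnits 𝔸).mul_mem ((unitaryUnits 𝔸).mul_mem ((unitaryUnits 𝔸).inv_mem (hUs x μ)) hTxU) (hUs x μ)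
  have hTx1 : ‖(Tx : 𝔸) - 1‖ ≤ 1 / 4 := by rw [hTx, norm_mul_inv_sub_one (hu x)]; exact hτx
  have hTy1 : ‖(Ty : 𝔸) - 1‖ = ‖(v (x + e μ) : 𝔸) - u (x + e μ)‖ := by rw [hTy, norm_mul_inv_sub_one (hu _)]
  have hTy4 : ‖(Ty : 𝔸) - 1‖ ≤ 1 / 4 := by rw [hTy1]; exact hτy
  have hTh1 : ‖(Th : 𝔸) - 1‖ ≤ 1 / 4 := by rw [hTh, norm_conj_sub_one (hUs x μ)]; exact hTx1
  -- the ratios `q = w v⁻¹` are fractional powers of `T`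
  have hqx : ((w x * (v x)⁻¹ : 𝔸ˣ) : 𝔸) = upow (φ x - 1) (Tx : 𝔸) :=
    glue_ratio_eq_upow hφ hw0 hw1 hwm hu (fun _ => by linarith)
  have hqy : ((w (x + e μ) * (v (x + e μ))⁻¹ : 𝔸ˣ) : 𝔸) = upow (φ (x + e μ) - 1) (Ty : 𝔸) :=
    glue_ratio_eq_upow hφ hw0 hw1 hwm hu (fun _ => by linarith)
  set a : ℝ := φ x - 1 with ha
  set c : ℝ := φ (x + e μ) - 1 with hc
  have ha1 : |a| ≤ 1 := by rw [ha, abs_le]; constructor <;> linarith [(hφ x).1, (hφ x).2]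
  have hc1 : |c| ≤ 1 := by rw [hc, abs_le]; constructor <;> linarith [(hφ (x + e μ)).1, (hφ (x + e μ)).2]
  have habs : |a| = 1 - φ x := by rw [ha, abs_sub_comm, abs_of_nonneg (by linarith [(hφ x).2])]
  -- `A = U_s⁻¹ q(x) U_s = Th^{a}` (conjugation covariance of the fractional power)
  set qx : 𝔸ˣ := w x * (v x)⁻¹ with hqxdef
  set qy : 𝔸ˣ := w (x + e μ) * (v (x + e μ))⁻¹ with hqydef
  set A' : 𝔸ˣ := (Us x μ)⁻¹ * qx * Us x μ with hA'def
  have hqyU : qy ∈ unitaryUnits 𝔸 := (unitaryUnits 𝔸).mul_mem hwy ((unitaryUnits 𝔸).inv_mem (hv _))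
  have hTxconj : (Tx : 𝔸) = (Us x μ : 𝔸) * (Th : 𝔸) * (((Us x μ)⁻¹ : 𝔸ˣ) : 𝔸) := by
    have : Tx = Us x μ * Th * (Us x μ)⁻¹ := by rw [hTh]; group
    conv_lhs => rw [this]
    simp only [Units.val_mul]
  have hA : (A' : 𝔸) = upow a (Th : 𝔸) := by
    have hU1 : Us x μ ∈ U1 𝔸 := mem_U1_of_unitaryUnits (hUs x μ)
    have hTh1' : ‖(Th : 𝔸) - 1‖ < 1 := by linarith
    rw [hA'def, Units.val_mul, Units.val_mul, hqx, hTxconj, upow_units_conj hU1 hTh1']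
    simp only [← mul_assoc, Units.inv_mul, one_mul, Units.inv_mul_cancel_right]
  have hAu : upow a (Th : 𝔸) ∈ unitary 𝔸 := upow_mem_unitary (mem_unitaryUnits.mp hThU) hTh1 a
  have hBu : upow c (Ty : 𝔸) ∈ unitary 𝔸 := upow_mem_unitary (mem_unitaryUnits.mp hTyU) hTy4 c
  set Yv : 𝔸ˣ := (Us x μ)⁻¹ * gaugeAct v U' x μ with hYv
  -- `Y_w − 1 = (A Y_v − B) B⁻¹`, `B = q(y)`
  have hnorm : ‖(((Us x μ)⁻¹ * gaugeAct w U' x μ : 𝔸ˣ) : 𝔸) - 1‖ = ‖upow a (Th : 𝔸) * (Yv : 𝔸) - upow c (Ty : 𝔸)‖ := by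
    rw [pairDefect_glue_eq (Us := Us) (U' := U') (v := v) (w := w) x μ]
    change ‖((A' * Yv * qy⁻¹ : 𝔸ˣ) : 𝔸) - 1‖ = _
    have hid : ((A' * Yv * qy⁻¹ : 𝔸ˣ) : 𝔸) - 1 = ((A' : 𝔸) * (Yv : 𝔸) - (qy : 𝔸)) * ((qy⁻¹ : 𝔸ˣ) : 𝔸) := by
      rw [sub_mul, Units.mul_inv, Units.val_mul, Units.val_mul]
    rw [hid, CStarRing.norm_mul_mem_unitary _ (mem_unitaryUnits.mp ((unitaryUnits 𝔸).inv_mem hqyU)), hA, hqydef, hqy]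
  rw [hnorm]
  -- `‖A Y_v − B‖ ≤ ‖Y_v − 1‖ + ‖A − B‖`
  have h1 : ‖upow a (Th : 𝔸) * (Yv : 𝔸) - upow c (Ty : 𝔸)‖ ≤ ‖(Yv : 𝔸) - 1‖ + ‖upow a (Th : 𝔸) - upow c (Ty : 𝔸)‖ := by
    have hid : upow a (Th : 𝔸) * (Yv : 𝔸) - upow c (Ty : 𝔸)
        = upow a (Th : 𝔸) * ((Yv : 𝔸) - 1) + (upow a (Th : 𝔸) - upow c (Ty : 𝔸)) := by noncomm_ring
    rw [hid]
    refine (norm_add_le _ _).trans ?_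
    rw [CStarRing.norm_mem_unitary_mul _ hAu]
  -- `‖A − B‖ ≤ 6|a|‖Th − Ty‖ + 4|a − c|‖Ty − 1‖`
  have h2 : ‖upow a (Th : 𝔸) - upow c (Ty : 𝔸)‖ ≤ 6 * |a| * ‖(Th : 𝔸) - Ty‖ + 4 * |a - c| * ‖(Ty : 𝔸) - 1‖ := by
    have hL := norm_upow_sub_upow_le_six (hTh1.trans (by norm_num)) (hTy4.trans (by norm_num)) ha1
    have hsplit : upow a (Ty : 𝔸) = upow (a - c) (Ty : 𝔸) * upow c (Ty : 𝔸) := by rw [← upow_add, sub_add_cancel]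
    have hM : ‖upow a (Ty : 𝔸) - upow c (Ty : 𝔸)‖ ≤ 4 * |a - c| * ‖(Ty : 𝔸) - 1‖ := by
      have hid : upow a (Ty : 𝔸) - upow c (Ty : 𝔸) = (upow (a - c) (Ty : 𝔸) - 1) * upow c (Ty : 𝔸) := by
        rw [hsplit]; noncomm_ring
      rw [hid, CStarRing.norm_mul_mem_unitary _ hBu]
      refine norm_upow_sub_one_le_lin le_rfl (hTy4.trans (by norm_num)) ?_
      have hac : |a - c| ≤ 1 := by
        rw [ha, hc, abs_le]; constructor <;> linarith [(hφ x).1, (hφ x).2, (hφ (x + e μ)).1, (hφ (x + e μ)).2]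
      nlinarith [abs_nonneg (a - c), norm_nonneg ((Ty : 𝔸) - 1)]
    calc ‖upow a (Th : 𝔸) - upow c (Ty : 𝔸)‖
        = ‖(upow a (Th : 𝔸) - upow a (Ty : 𝔸)) + (upow a (Ty : 𝔸) - upow c (Ty : 𝔸))‖ := by rw [sub_add_sub_cancel]
      _ ≤ ‖upow a (Th : 𝔸) - upow a (Ty : 𝔸)‖ + ‖upow a (Ty : 𝔸) - upow c (Ty : 𝔸)‖ := norm_add_le _ _
      _ ≤ _ := add_le_add hL hM
  -- `‖Th − Ty‖ ≤ err_u + err_v` (transport letter)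
  have h3 : ‖(Th : 𝔸) - Ty‖ ≤ ‖(((Us x μ)⁻¹ * gaugeAct u U' x μ : 𝔸ˣ) : 𝔸) - 1‖ + ‖(Yv : 𝔸) - 1‖ := by
    rw [norm_sub_rev, hTy, hTh, hTx]
    exact norm_ratio_sub_conj_le hUs hU' hu hv x μ
  have hac' : |a - c| = |φ x - φ (x + e μ)| := by rw [ha, hc]; ring_nf
  rw [habs, hac', hTy1] at h2
  have h60 : 0 ≤ 6 * (1 - φ x) := by linarith [(hφ x).2]
  have h4 := mul_le_mul_of_nonneg_left h3 h60
  linarith [h1, h2, h4]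

end Letters

end

end Summit.QuantumFields.BalabanUV.T4Continuum.NE7PairGlueStep
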